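import Summits.Ventures.QEC.CircuitDistance.PortK2DataBB144Z
import Summits.Ventures.QEC.CircuitDistance.K2Chunks
import HarnessLib

/-!
# K2(`[[144,12,12]]`) chunk module — COMPUTATIONAL (native_decide; `Lean.ofReduceBool`)

Cell `qec`, CDX, R146/R152 STEP 1 («computational» header; `ofReduceBool` confined to these chunk modules). Checker of record
`K2.K2Data` (qec-cdx-type-1, PortK2Check); data module of record `PortK2DataBB144X/Z` (p669158/9, crit-1 data audit PASS
2026-08-28T21:20Z); chunk glue `K2Chunks` (idea-1 g2). Cube 0, child 11: leaf group 3 of 6.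
Leaf theorems: the K2 DFS accepts below one descendant state of pivot cube 0 (sector Z); sizes are exact DFS visit counts
(eng-1 g2 `k2count.c`), capped so that the gate's native-axiom audit re-verifies every leaf in place. Assemblies re-derive the
child lists in the kernel (`decide`) and end in the literal cube fact `d144Z.cube (Ts144Z.getD 0 []) (0) (lives144Z.getD 0 0) = true`
(the `hcubes` hypothesis of `K2Inst.k2_complete`). Emitted by qec-cdx-eng-1 g2 (`gen2.py`, idea-1's `gen_k2chunks_from_lean.py` lineage).
-/

namespace Summit.Ventures.QEC.CircuitDistance.K2

set_option maxRecDepth 100000 in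
set_option maxHeartbeats 0 in
set_option exponentiation.threshold 1024 in
/-- K2(144) chunk fact `cube144Z0_ch11_4` (546548 DFS visits; see the module docstring). -/
theorem cube144Z0_ch11_4 : app5 (d144Z.dfs (Ts144Z.getD 0 []) 6) (74959055690047440896, 3724, 421249166674228746791672110734681729276199351621839135154693472257, 3, 2348542582773833227889480596789337027375682127659153196089422198974514062791347233678408240874292227004694492) = true := by native_decide

set_option maxRecDepth 100000 in
set_option maxHeartbeats 0 in
set_option exponentiation.threshold 1024 in
/-- K2(144) chunk fact `cube144Z0_ch11_5` (503950 DFS visits; see the module docstring). -/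
theorem cube144Z0_ch11_5 : app5 (d144Z.dfs (Ts144Z.getD 0 []) 6) (374759249653218148352, 12, 421249166674228746792028922657858219245844953094558818801339596801, 3, 2348542582773833227889480596789337027375682127659153196089422198617702139614857263413836748511918442909007836) = true := by native_decide

set_option maxRecDepth 100000 in
set_option maxHeartbeats 0 in
set_option exponentiation.threshold 1024 in
/-- K2(144) chunk fact `cube144Z0_ch11_6` (257544 DFS visits; see the module docstring). -/
theorem cube144Z0_ch11_6 : app5 (d144Z.dfs (Ts144Z.getD 0 []) 6) (2454625632945551966464, 1676, 421249166674228746794526606120093649037696953541095435290009403393, 3, 2348542582773833227889480596789337027375682127659153196089422195763206754202937501297264809612928170143514588) = true := by native_decide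

set_option maxRecDepth 100000 in
set_option maxHeartbeats 0 in
set_option exponentiation.threshold 1024 in
/-- K2(144) chunk fact `cube144Z0_ch11_7` (247051 DFS visits; see the module docstring). -/
theorem cube144Z0_ch11_7 : app5 (d144Z.dfs (Ts144Z.getD 0 []) 6) (1257892548213691402240, 3724, 421249166674228746974359815401044594051040985691731822474235478017, 3, 2348542582773833227889480596789337027375682127659153196089422013075502087840072725836660720077550713151946716) = true := by native_decide

set_option maxRecDepth 100000 in
set_option maxHeartbeats 0 in
set_option exponentiation.threshold 1024 in
/-- K2(144) chunk fact `cube144Z0_ch11_8` (493469 DFS visits; see the module docstring). -/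
theorem cube144Z0_ch11_8 : app5 (d144Z.dfs (Ts144Z.getD 0 []) 6) (374718646887829737536, 12, 421249166674228770175698308029128420534537705062724759512164597761, 3, 2348542582773833227889480596789337027375682127659153196089398629049304793393381466879337259549236218231259100) = true := by native_decide
end Summit.Ventures.QEC.CircuitDistance.K2
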